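import Summits.BirchSwinnertonDyer.BirchSwinnertonDyer.Theorems.KatoDescentPotSupersingularKatoFiniteLevelCount
import Summits.BirchSwinnertonDyer.Rank1Residual.GaloisImage.KolyvaginLevelStructures
import HarnessLib

set_option autoImplicit false

/-!
# (R1-d) AT FINITE LEVEL: the Poitou–Tate comparison of the `n`-descent structure `𝓚` (Kummer everywhere) with the
# structure `𝓚 ⊔ H¹_ur` RELAXED TO «Kummer + unramified» at a finite set `Σ` of finite places `v ∤ n` —
# `#H¹_{𝓚 ⊔ ur@Σ}(K, E[n]) · ∏_{v∈Σ} #𝓚_v = #H¹_{𝓚 ⊓ ur@Σ}(K, E[n]) · ∏_{v∈Σ} #(𝓚_v ⊔ H¹_ur(K_v, E[n]))`,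
# i.e. `[H¹_{𝓚 ⊔ ur@Σ} : H¹_{𝓚 ⊓ ur@Σ}] = ∏_{v∈Σ} [𝓚_v ⊔ H¹_ur : 𝓚_v]` — brick (c), step (R1-d)₁ of the COUNT lane
# (seat `bsd-cm-prr-ty1` g11, cell `bsd-cm`; theorems only: no definition, no named fact, no instance, no `sorry`)

Part 22 of the seat's kernel cut of stub 3 `stub_rankOneCountReadingKato` of the Kato–Perrin-Riou skeletons v4 (cruxes
stmt-BirchSwinnertonDyer-19945 / -19223; = cell bsd-potss's held input 27322).  The displayed counting residual of stub 3
is COUNT-FINE⁰ (Part 17, `KatoDescentH2CoinvariantsFineSelmer`); inside Kato's count of `#H²(ℤ[1/p], T_pE)` (the potss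
memo KMC-DESCENT-MEMO §4, (R1-a)…(R1-f)) the step (R1-d) is the POITOU–TATE COMPARISON of the two Selmer structures
`ℱ = Kummer ⊂ ℱ′ = (Kummer at p, UNRAMIFIED at the bad ℓ ≠ p)`: «`0 → Sel → S(T) → ⊕_{ℓ≠p} H¹_ur(ℚ_ℓ, E[p^∞])/… →
Sel_{ℱ*}(T)^∨ → Sel_{ℱ′*}(T)^∨ → 0`, so `#(S(T)/Sel) = C′/#(ℤ_pκ(P)/𝔥) = C′/p^a`» (Rubin, *Euler Systems* Thm. 1.7.3 /
DDT Thm. 2.19 / Milne I Thm. 4.10).  THIS FILE proves its FINITE-LEVEL form, exactly, over every number field: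

* §1 (the annihilator of a join is the meet of the annihilators, `(A ⊔ B)^* = A^* ⊓ B^*` — n1011
  `CoreRankZero.dualLocalCondition_sup`) `dualTransported_inr_eq_inf_of_apply_eq_sup` — for the `n`-torsion module `E[n]` of an
  elliptic curve (`n` an odd prime power), a Weil pairing `e`, a PERFECT family `inv` and a finite `v ∤ n`:
  **`θ⁻¹((𝓚_v ⊔ H¹_ur)^*) = 𝓚_v ⊓ H¹_ur`** — from `θ⁻¹(𝓚_v^*) = 𝓚_v` (Tate local duality for `E`, n1011
  `dualTransported_kummerSelmerStructure_inr`, Milne I Cor. 3.4 + Thm. 2.8) and `θ⁻¹((H¹_ur)^*) = H¹_ur` at the possibly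
  RAMIFIED `v ∤ n` (cell bsd-potss, `dualTransported_eq_unramifiedSubgroup_of_apply_eq`, Milne I Thm. 2.6).
* §2 **`natCard_selmerGroup_kummerSupUnramified_mul`** (hypothesis form; `K : Type u`): for an odd prime power `n`, a
  Poitou–Tate family `inv` (`IsPerfect`, `SumLocalTermEqZero`, `SelmerComplement`), Weil data `e`, finite sets `Σ ⊆ T` of
  finite places with `v ∤ n` on `Σ`, `T ⊇ {v ∣ n} ∪ Ram(E[n])` and `𝓚_v = H¹_ur` off `T`, and ANY Selmer structures
  `𝓖`, `𝓖'` on `E[n]` with `𝓖_v = 𝓚_v ⊔ H¹_ur(K_v, E[n])`, `𝓖'_v = 𝓚_v ⊓ H¹_ur(K_v, E[n])` for `v ∈ Σ` and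
  `𝓖_v = 𝓖'_v = 𝓚_v` at every other finite place (anything at `∞`, where `H¹ = 0`):
  **`#H¹_𝓖(K, E[n]) · ∏_{v∈Σ} #𝓚_v = #H¹_{𝓖'}(K, E[n]) · ∏_{v∈Σ} #(𝓚_v ⊔ H¹_ur(K_v, E[n]))`.**
  Proof: the pair count (n1011 `GaloisImage.card_selmerGroup_pair`, Howard Thm. 2.1.11 / Milne I 4.10 / DDT 2.19)
  `#H¹_𝓖 · #H¹_{𝓕^*} · ∏_T #𝓕_v = #H¹_𝓕 · #H¹_{𝓖^*} · ∏_T #𝓖_v` for `𝓕 := (𝓚 at the finite places, 𝓖 at ∞) ≤ 𝓖`; the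
  dual Selmer groups on `E[n]^D` are identified through the Weil transport `θ` (cell bsd-potss
  `natCard_selmerGroup_eq_natCard_dualSelmerGroup_of_dualTransported`): `#H¹_{𝓕^*} = #H¹_𝓕` (`θ⁻¹(𝓚_v^*) = 𝓚_v`) and
  `#H¹_{𝓖^*} = #H¹_{𝓖'}` (§1); the positive factor `#H¹_𝓕 · ∏_{T∖Σ} #𝓚_v` cancels.
  `relIndex_selmerGroup_kummerInfUnramified_eq` — the INDEX FORM **`[H¹_𝓖 : H¹_{𝓖'}] = ∏_{v∈Σ} [𝓚_v ⊔ H¹_ur : 𝓚_v]`**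
  (`= ∏_{v∈Σ} [H¹_ur(K_v, E[n]) : 𝓚_v ⊓ H¹_ur]`, second isomorphism theorem).
* The sequel `KatoDescentKummerUnramifiedCountDischarged` gives the same count UNCONDITIONALLY for `n = p^k` over `K : Type`
  (Poitou–Tate from `poitouTate_selmerStructure_duality_holds K`, Weil data from `exists_weilPairing_holds`).

WHY (the lane).  On the rows of stub 3 (`W/ℚ` of rank one, `p` odd of additive potentially good reduction, `Σ` = the
bad primes `≠ p`): as `k → ∞`, `H¹_{𝓖}(ℚ, W[p^k])` recovers Kato's `S(T)[p^k]` (classes unramified at `ℓ ≠ p`, `f` at `p`;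
`H¹_ur(ℚ_ℓ, W[p^∞]) = 0` at good `ℓ`), `H¹_{𝓖'}` the Selmer classes unramified at `Σ`, whose `T_p`-limit is
`𝔥 = H¹(ℤ[1/p], T_pW) = p^a ℤ_p κ_∞(P)` inside `lim H¹_𝓚 = ℤ_p κ_∞(P)` (Parts 19–21: E10/E11), and the local index
`[𝓚_ℓ ⊔ H¹_ur : 𝓚_ℓ] = #H¹_ur(ℚ_ℓ, W[p^k]) = #W(ℚ_ℓ)[p^k]` at an additive `ℓ ≠ p` once `p^k` kills `W(ℚ_ℓ^nr)[p^∞]`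
(n1011 `Additive/UnramifiedKummerDisjoint`), `= p^{v_p c_ℓ}` for `k ≫ 0` (cell bsd-potss, part 24).  The passage to the
limit is NOT done here.

HONEST LABEL: theorems only; no stub or item is closed; nothing is registered; nothing is asserted on 19945 / 19223;
Kato's Main Conjecture and Perrin-Riou's conjecture are not touched; BSD is not proved for any curve.

References: [Rubin2000] Thm. 1.7.3; [DarmonDiamondTaylor1995] Thm. 2.19; [MilneADT2006] Ch. I Thm. 2.6, Thm. 2.8, Cor. 3.4,
Lemma 3.3, Thm. 4.10; [Howard2004HeegnerKolyvagin] Def. 2.1.6, Thm. 2.1.11 (arXiv:1202.6340 pp. 5–6); [Kato2004Asterisque]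
§14.8 (p. 238), (14.9.3) (p. 240); [GreenbergLNM1716] §3 (p. 74); [SilvermanAEC2009] III.8.1, VII.4.1.
-/

noncomputable section

open scoped Classical ContRepresentation NumberField
open Function Field NumberField IsDedekindDomain WeierstrassCurve
open Literature.NumberTheory.EllipticCurves Literature.NumberTheory.GaloisRepresentations
  Literature.NumberTheory.GaloisRepresentations.DiscreteGaloisModule Literature.NumberTheory.GaloisCohomology
open Summit.BirchSwinnertonDyer.Rank1Residual.X11b.Levels Summit.BirchSwinnertonDyer.Rank1Residual.X11b.LocBridge
open Summit.BirchSwinnertonDyer.Rank1Residual.GaloisImage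
open Summit.BirchSwinnertonDyer.BirchSwinnertonDyer.Theorems.KatoFiniteLevelCount

universe u

namespace Summit.BirchSwinnertonDyer.Rank1Residual.Additive.KummerUnramified

/-! ## §1 Transported duals of joins; the transported dual of `𝓚_v ⊔ H¹_ur` is `𝓚_v ⊓ H¹_ur` -/

section Annihilator

variable {K : Type u} [Field K] [NumberField K] {n : ℕ} {M : Type u} [AddCommGroup M] [TopologicalSpace M]
  [DiscreteTopology M] [Finite M]

/-- **Transported duals of joins**: if `𝓒_v = 𝓐_v ⊔ 𝓑_v` then `θ⁻¹(𝓒_v^*) = θ⁻¹(𝓐_v^*) ⊓ θ⁻¹(𝓑_v^*)` for every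
transport `θ : M → M^D`. [cite: Howard2004HeegnerKolyvagin, Def. 2.1.6 (arXiv:1202.6340 p. 5)] -/
theorem dualTransported_eq_inf_of_apply_eq_sup (inv : LocalInvariants K n) {ρ : DiscreteGaloisModule K M}
    (θ : ρ.toContRepresentation →ⁱL (ρ.tateDual n).toContRepresentation) (𝓐 𝓑 𝓒 : SelmerStructure ρ)
    (v : Place K) (h : 𝓒 v = 𝓐 v ⊔ 𝓑 v) :
    inv.dualTransported 𝓒 θ v = inv.dualTransported 𝓐 θ v ⊓ inv.dualTransported 𝓑 θ v := by
  ext x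
  simp only [AddSubgroup.mem_inf, LocalInvariants.mem_dualTransported_iff, LocalInvariants.dualSelmerStructure_apply,
    h, CoreRankZero.dualLocalCondition_sup]

end Annihilator

section WeilData

variable {K : Type u} [Field K] [NumberField K] (W : WeierstrassCurve K) (n : ℕ) [NeZero n] [W.IsElliptic]
  [Finite (geomTorsion W n)]
variable (e : geomTorsion W n → geomTorsion W n → AlgebraicClosure K)
  (hμ : ∀ S T, e S T ^ n = 1)
  (hadd₁ : ∀ S₁ S₂ T, e (S₁ + S₂) T = e S₁ T * e S₂ T)
  (hadd₂ : ∀ S T₁ T₂, e S (T₁ + T₂) = e S T₁ * e S T₂)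
  (hgal : ∀ (σ : absoluteGaloisGroup K) (S T : geomTorsion W n), σ • e S T = e (σ • S) (σ • T))

/-- **`θ⁻¹((𝓚_v ⊔ H¹_ur)^*) = 𝓚_v ⊓ H¹_ur` at a finite `v ∤ n`** for the `n`-torsion `E[n]` of an elliptic curve (`n` an odd
prime power, `inv` perfect): the transported dual of the local condition «Kummer + unramified» is «Kummer AND unramified» —
`θ⁻¹(𝓚_v^*) = 𝓚_v` (Tate local duality for `E`, Milne I Cor. 3.4 with Thm. 2.8) and `θ⁻¹((H¹_ur)^*) = H¹_ur` (Milne I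
Thm. 2.6, in the form valid for the possibly ramified `E[n]` at `v ∤ n`).
[cite: MilneADT2006, Ch. I, Thm. 2.6 and Cor. 3.4] [cite: Howard2004HeegnerKolyvagin, Def. 2.1.6 (arXiv:1202.6340 p. 5)] -/
theorem dualTransported_inr_eq_inf_of_apply_eq_sup
    (halt : ∀ T, e T T = 1) (hnondeg : ∀ T, (∀ S, e S T = 1) → T = 0) (hn : IsPrimePow n)
    (inv : LocalInvariants K n) (hperf : inv.IsPerfect) (𝓖 : SelmerStructure (W.torsionGaloisModule n))
    (v : HeightOneSpectrum (𝓞 K)) (hv : ((n : ℕ) : 𝓞 K) ∉ v.asIdeal)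
    (h𝓖 : 𝓖 (Sum.inr v) = W.kummerSelmerStructure n (Sum.inr v) ⊔
      unramifiedSubgroup (GaloisRep.toLocal v (W.torsionGaloisModule n)) 1) :
    inv.dualTransported 𝓖 (weilDualIntertwining W n e hμ hadd₁ hadd₂ hgal) (Sum.inr v) =
      W.kummerSelmerStructure n (Sum.inr v) ⊓ unramifiedSubgroup (GaloisRep.toLocal v (W.torsionGaloisModule n)) 1 := by
  -- the auxiliary structure «unramified at the finite places, `⊥` at `∞`»
  let 𝓤 : SelmerStructure (W.torsionGaloisModule n) := fun v =>
    match v with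
    | Sum.inl _ => ⊥
    | Sum.inr v => unramifiedSubgroup (GaloisRep.toLocal v (W.torsionGaloisModule n)) 1
  have h𝓤 : 𝓤 (Sum.inr v) = unramifiedSubgroup (GaloisRep.toLocal v (W.torsionGaloisModule n)) 1 := rfl
  have hEP : localEulerPoincareCharacteristic (v.adicCompletion K) := by
    haveI : CharZero (v.adicCompletion K) := charZero_adicCompletion v
    exact localEulerPoincareCharacteristic_holds (v.adicCompletion K)
  rw [dualTransported_eq_inf_of_apply_eq_sup inv (weilDualIntertwining W n e hμ hadd₁ hadd₂ hgal)
    (W.kummerSelmerStructure n) 𝓤 𝓖 (Sum.inr v) (h𝓖.trans (by rw [h𝓤])),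
    dualTransported_kummerSelmerStructure_inr W n e hμ hadd₁ hadd₂ hgal halt hnondeg hn v hEP inv (hperf v).1.1,
    dualTransported_eq_unramifiedSubgroup_of_apply_eq W n e hμ hadd₁ hadd₂ hgal hnondeg hn inv hperf 𝓤 v hv h𝓤]

/-! ## §2 The count `#H¹_{𝓚 ⊔ ur@Σ} · ∏_Σ #𝓚_v = #H¹_{𝓚 ⊓ ur@Σ} · ∏_Σ #(𝓚_v ⊔ H¹_ur)` (hypothesis form) -/

include hμ hadd₁ hadd₂ hgal in
/-- **(R1-d) at finite level — the Poitou–Tate comparison of `𝓚` with `𝓚 ⊔ H¹_ur` relaxed at `Σ`.**  Here `n` is an odd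
prime power, `inv` a Poitou–Tate family (`IsPerfect`, `SumLocalTermEqZero`, `SelmerComplement`), `e` Weil-pairing data on
`E[n]`, `Σ ⊆ T` finite sets of finite places with `v ∤ n` for `v ∈ Σ`, `T ⊇ {v ∣ n} ∪ Ram(E[n])` and `𝓚_v = H¹_ur(K_v, E[n])`
at the finite `v ∉ T`; `𝓖`, `𝓖'` are ANY Selmer structures on `E[n]` with `𝓖_v = 𝓚_v ⊔ H¹_ur`, `𝓖'_v = 𝓚_v ⊓ H¹_ur` for
`v ∈ Σ` and `𝓖_v = 𝓖'_v = 𝓚_v` at the other finite places (no condition at the infinite places, where `H¹ = 0`).  Then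
`#H¹_𝓖(K, E[n]) · ∏_{v∈Σ} #𝓚_v = #H¹_{𝓖'}(K, E[n]) · ∏_{v∈Σ} #(𝓚_v ⊔ H¹_ur(K_v, E[n]))`.  (Rubin Thm. 1.7.3 / DDT Thm. 2.19:
`#H¹_𝓖 / #H¹_{𝓖^*} = #H¹_𝓕 / #H¹_{𝓕^*} · ∏_v [𝓖_v : 𝓕_v]` for `𝓕 ≤ 𝓖`, with `𝓕 = 𝓚` self-dual and `𝓖^* ≅ 𝓖'` through the
Weil transport.) [cite: Rubin2000, Thm. 1.7.3] [cite: MilneADT2006, Ch. I, Thm. 4.10, Cor. 3.4 and Thm. 2.6]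
[cite: Howard2004HeegnerKolyvagin, Thm. 2.1.11 (arXiv:1202.6340 p. 6)] -/
theorem natCard_selmerGroup_kummerSupUnramified_mul
    (halt : ∀ T, e T T = 1) (hnondeg : ∀ T, (∀ S, e S T = 1) → T = 0) (hn : IsPrimePow n) (hodd : Odd n)
    (inv : LocalInvariants K n) (hperf : inv.IsPerfect) (hsum : inv.SumLocalTermEqZero)
    (hcompl : inv.SelmerComplement)
    (Q T : Finset (HeightOneSpectrum (𝓞 K))) (hQT : Q ⊆ T)
    (hQn : ∀ v ∈ Q, ((n : ℕ) : 𝓞 K) ∉ v.asIdeal)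
    (hTn : ∀ v : HeightOneSpectrum (𝓞 K), ((n : ℕ) : 𝓞 K) ∈ v.asIdeal → v ∈ T)
    (hT : ∀ v : HeightOneSpectrum (𝓞 K), v ∉ T → GaloisRep.IsUnramifiedAt v (W.torsionGaloisModule n))
    (h𝓚T : ∀ v : HeightOneSpectrum (𝓞 K), v ∉ T →
      W.kummerSelmerStructure n (Sum.inr v) = unramifiedSubgroup (GaloisRep.toLocal v (W.torsionGaloisModule n)) 1)
    (𝓖 𝓖' : SelmerStructure (W.torsionGaloisModule n))
    (h𝓖Q : ∀ v ∈ Q, 𝓖 (Sum.inr v) = W.kummerSelmerStructure n (Sum.inr v) ⊔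
      unramifiedSubgroup (GaloisRep.toLocal v (W.torsionGaloisModule n)) 1)
    (h𝓖nQ : ∀ v ∉ Q, 𝓖 (Sum.inr v) = W.kummerSelmerStructure n (Sum.inr v))
    (h𝓖'Q : ∀ v ∈ Q, 𝓖' (Sum.inr v) = W.kummerSelmerStructure n (Sum.inr v) ⊓
      unramifiedSubgroup (GaloisRep.toLocal v (W.torsionGaloisModule n)) 1)
    (h𝓖'nQ : ∀ v ∉ Q, 𝓖' (Sum.inr v) = W.kummerSelmerStructure n (Sum.inr v)) :
    Nat.card 𝓖.selmerGroup * ∏ v ∈ Q, Nat.card (W.kummerSelmerStructure n (Sum.inr v)) =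
      Nat.card 𝓖'.selmerGroup * ∏ v ∈ Q, Nat.card ↥(W.kummerSelmerStructure n (Sum.inr v) ⊔
        unramifiedSubgroup (GaloisRep.toLocal v (W.torsionGaloisModule n)) 1) := by
  have hnM : ∀ m : geomTorsion W n, n • m = 0 := fun m => AddSubgroup.torsionBy.nsmul m
  -- the `n`-descent structure `𝓚`, adjusted to agree with `𝓖` at the infinite places (where `H¹ = 0` anyway)
  let 𝓕 : SelmerStructure (W.torsionGaloisModule n) := fun v =>
    match v with
    | Sum.inl w => 𝓖 (Sum.inl w)
    | Sum.inr v => W.kummerSelmerStructure n (Sum.inr v)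
  have h𝓕inr : ∀ v : HeightOneSpectrum (𝓞 K), 𝓕 (Sum.inr v) = W.kummerSelmerStructure n (Sum.inr v) :=
    fun v => rfl
  have hle : 𝓕 ≤ 𝓖 := by
    intro v
    rcases v with w | v
    · exact le_rfl
    · rw [h𝓕inr]
      by_cases hv : v ∈ Q
      · rw [h𝓖Q v hv]; exact le_sup_left
      · rw [h𝓖nQ v hv]
  -- unramified outside `S(T)`
  have hnotT : ∀ v : HeightOneSpectrum (𝓞 K), (Sum.inr v : Place K) ∉ finSupport T → v ∉ T :=
    fun v hv h => hv ((inr_mem_finSupport_iff T v).2 h)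
  have hnotQ : ∀ v : HeightOneSpectrum (𝓞 K), v ∉ T → v ∉ Q := fun v hv h => hv (hQT h)
  have h𝓕T : 𝓕.IsUnramifiedOutside (finSupport T) :=
    ⟨fun w => inl_mem_finSupport T w, fun v hv => (h𝓕inr v).trans (h𝓚T v (hnotT v hv))⟩
  have h𝓖T : 𝓖.IsUnramifiedOutside (finSupport T) :=
    ⟨fun w => inl_mem_finSupport T w, fun v hv =>
      (h𝓖nQ v (hnotQ v (hnotT v hv))).trans (h𝓚T v (hnotT v hv))⟩
  have h𝓖'T : 𝓖'.IsUnramifiedOutside (finSupport T) :=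
    ⟨fun w => inl_mem_finSupport T w, fun v hv =>
      (h𝓖'nQ v (hnotQ v (hnotT v hv))).trans (h𝓚T v (hnotT v hv))⟩
  have hS : ∀ v : HeightOneSpectrum (𝓞 K), v ∉ T →
      ((n : ℕ) : 𝓞 K) ∉ v.asIdeal ∧ GaloisRep.IsUnramifiedAt v (W.torsionGaloisModule n) :=
    fun v hv => ⟨fun h => hv (hTn v h), hT v hv⟩
  have hT' : ∀ v : HeightOneSpectrum (𝓞 K), (Sum.inr v : Place K) ∉ finSupport T →
      GaloisRep.IsUnramifiedAt v (W.torsionGaloisModule n) := fun v hv => hT v (hnotT v hv)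
  -- the pair count for `𝓕 ≤ 𝓖`
  have hpair := card_selmerGroup_pair (W.torsionGaloisModule n) T inv hperf hsum hcompl hnM hS hle h𝓕T h𝓖T
    (fun w => rfl)
  -- finiteness of the Selmer groups involved
  haveI : Finite 𝓕.selmerGroup :=
    SelmerFinite.finite_selmerGroup_of_isUnramifiedOutside (W.torsionGaloisModule n) hT' h𝓕T
  haveI : Finite 𝓖'.selmerGroup :=
    SelmerFinite.finite_selmerGroup_of_isUnramifiedOutside (W.torsionGaloisModule n) hT' h𝓖'T
  -- the two dual Selmer groups, through `θ`
  have hEP : ∀ v : HeightOneSpectrum (𝓞 K), localEulerPoincareCharacteristic (v.adicCompletion K) :=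
    fun v => by
      haveI : CharZero (v.adicCompletion K) := charZero_adicCompletion v
      exact localEulerPoincareCharacteristic_holds (v.adicCompletion K)
  have hinv : ∀ v : HeightOneSpectrum (𝓞 K), Injective (inv (Sum.inr v)) := fun v => (hperf v).1.1
  have hK : ∀ v : HeightOneSpectrum (𝓞 K),
      inv.dualTransported (W.kummerSelmerStructure n) (weilDualIntertwining W n e hμ hadd₁ hadd₂ hgal) (Sum.inr v) =
        W.kummerSelmerStructure n (Sum.inr v) :=
    fun v => dualTransported_kummerSelmerStructure_inr W n e hμ hadd₁ hadd₂ hgal halt hnondeg hn v (hEP v) inv (hinv v)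
  -- `θ⁻¹(𝓑_v^*)` depends only on `𝓑_v`
  have htransp : ∀ (𝓐 𝓑 : SelmerStructure (W.torsionGaloisModule n)) (v : Place K), 𝓐 v = 𝓑 v →
      inv.dualTransported 𝓐 (weilDualIntertwining W n e hμ hadd₁ hadd₂ hgal) v =
        inv.dualTransported 𝓑 (weilDualIntertwining W n e hμ hadd₁ hadd₂ hgal) v := fun 𝓐 𝓑 v h => by
    ext x
    simp only [LocalInvariants.mem_dualTransported_iff, LocalInvariants.dualSelmerStructure_apply, h]
  have hdual𝓕 : Nat.card 𝓕.selmerGroup =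
      Nat.card (inv.dualSelmerStructure (W.torsionGaloisModule n) 𝓕).selmerGroup := by
    refine natCard_selmerGroup_eq_natCard_dualSelmerGroup_of_dualTransported W n e hμ hadd₁ hadd₂ hgal hnondeg
      hodd inv 𝓕 𝓕 fun v => ?_
    rw [htransp 𝓕 (W.kummerSelmerStructure n) (Sum.inr v) (h𝓕inr v), hK v, h𝓕inr v]
  have hdual𝓖 : Nat.card 𝓖'.selmerGroup =
      Nat.card (inv.dualSelmerStructure (W.torsionGaloisModule n) 𝓖).selmerGroup := by
    refine natCard_selmerGroup_eq_natCard_dualSelmerGroup_of_dualTransported W n e hμ hadd₁ hadd₂ hgal hnondeg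
      hodd inv 𝓖' 𝓖 fun v => ?_
    by_cases hv : v ∈ Q
    · rw [h𝓖'Q v hv]
      exact dualTransported_inr_eq_inf_of_apply_eq_sup W n e hμ hadd₁ hadd₂ hgal halt hnondeg hn inv hperf 𝓖 v
        (hQn v hv) (h𝓖Q v hv)
    · rw [htransp 𝓖 (W.kummerSelmerStructure n) (Sum.inr v) (h𝓖nQ v hv), hK v, h𝓖'nQ v hv]
  -- the local products over `T = Q ⊔ (T \ Q)`
  have hprod𝓕 : ∏ v ∈ T, Nat.card (𝓕 (Sum.inr v)) =
      (∏ v ∈ T \ Q, Nat.card (W.kummerSelmerStructure n (Sum.inr v))) *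
        ∏ v ∈ Q, Nat.card (W.kummerSelmerStructure n (Sum.inr v)) := by
    rw [← Finset.prod_sdiff hQT]
  have hprod𝓖 : ∏ v ∈ T, Nat.card (𝓖 (Sum.inr v)) =
      (∏ v ∈ T \ Q, Nat.card (W.kummerSelmerStructure n (Sum.inr v))) *
        ∏ v ∈ Q, Nat.card ↥(W.kummerSelmerStructure n (Sum.inr v) ⊔
          unramifiedSubgroup (GaloisRep.toLocal v (W.torsionGaloisModule n)) 1) := by
    rw [← Finset.prod_sdiff hQT]
    congr 1
    · exact Finset.prod_congr rfl fun v hv => by rw [h𝓖nQ v (Finset.mem_sdiff.1 hv).2]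
    · exact Finset.prod_congr rfl fun v hv => by rw [h𝓖Q v hv]
  rw [hprod𝓕, hprod𝓖, ← hdual𝓕, ← hdual𝓖] at hpair
  -- cancel the positive factor `#H¹_𝓕 · ∏_{T \ Q} #𝓚_v`
  have hpos : 0 < Nat.card 𝓕.selmerGroup * ∏ v ∈ T \ Q, Nat.card (W.kummerSelmerStructure n (Sum.inr v)) := by
    refine Nat.mul_pos Nat.card_pos (Finset.prod_pos fun v _ => ?_)
    haveI : CharZero (v.adicCompletion K) := charZero_adicCompletion v
    haveI : Finite (galoisCohomology ((W.torsionGaloisModule n).toLocal (Sum.inr v)) 1) :=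
      finite_galoisCohomology_one_of_isNonarchimedeanLocalField (GaloisRep.toLocal v (W.torsionGaloisModule n))
    haveI : Finite (W.kummerSelmerStructure n (Sum.inr v)) := inferInstance
    exact Nat.card_pos
  refine Nat.eq_of_mul_eq_mul_left hpos ?_
  set A := Nat.card 𝓕.selmerGroup
  set B := ∏ v ∈ T \ Q, Nat.card (W.kummerSelmerStructure n (Sum.inr v))
  set C := ∏ v ∈ Q, Nat.card (W.kummerSelmerStructure n (Sum.inr v))
  set D := ∏ v ∈ Q, Nat.card ↥(W.kummerSelmerStructure n (Sum.inr v) ⊔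
    unramifiedSubgroup (GaloisRep.toLocal v (W.torsionGaloisModule n)) 1)
  calc A * B * (Nat.card 𝓖.selmerGroup * C) = Nat.card 𝓖.selmerGroup * A * (B * C) := by ring
    _ = A * Nat.card 𝓖'.selmerGroup * (B * D) := hpair
    _ = A * B * (Nat.card 𝓖'.selmerGroup * D) := by ring

include hμ hadd₁ hadd₂ hgal in
/-- **The index form of (R1-d) at finite level**: with the hypotheses of `natCard_selmerGroup_kummerSupUnramified_mul`,
`H¹_{𝓖'}(K, E[n]) ≤ H¹_𝓖(K, E[n])` and `[H¹_𝓖 : H¹_{𝓖'}] = ∏_{v∈Σ} [𝓚_v ⊔ H¹_ur(K_v, E[n]) : 𝓚_v]`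
(`AddSubgroup.relIndex`). [cite: Rubin2000, Thm. 1.7.3] [cite: MilneADT2006, Ch. I, Thm. 4.10] -/
theorem relIndex_selmerGroup_kummerInfUnramified_eq
    (halt : ∀ T, e T T = 1) (hnondeg : ∀ T, (∀ S, e S T = 1) → T = 0) (hn : IsPrimePow n) (hodd : Odd n)
    (inv : LocalInvariants K n) (hperf : inv.IsPerfect) (hsum : inv.SumLocalTermEqZero)
    (hcompl : inv.SelmerComplement)
    (Q T : Finset (HeightOneSpectrum (𝓞 K))) (hQT : Q ⊆ T)
    (hQn : ∀ v ∈ Q, ((n : ℕ) : 𝓞 K) ∉ v.asIdeal)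
    (hTn : ∀ v : HeightOneSpectrum (𝓞 K), ((n : ℕ) : 𝓞 K) ∈ v.asIdeal → v ∈ T)
    (hT : ∀ v : HeightOneSpectrum (𝓞 K), v ∉ T → GaloisRep.IsUnramifiedAt v (W.torsionGaloisModule n))
    (h𝓚T : ∀ v : HeightOneSpectrum (𝓞 K), v ∉ T →
      W.kummerSelmerStructure n (Sum.inr v) = unramifiedSubgroup (GaloisRep.toLocal v (W.torsionGaloisModule n)) 1)
    (𝓖 𝓖' : SelmerStructure (W.torsionGaloisModule n))
    (h𝓖Q : ∀ v ∈ Q, 𝓖 (Sum.inr v) = W.kummerSelmerStructure n (Sum.inr v) ⊔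
      unramifiedSubgroup (GaloisRep.toLocal v (W.torsionGaloisModule n)) 1)
    (h𝓖nQ : ∀ v ∉ Q, 𝓖 (Sum.inr v) = W.kummerSelmerStructure n (Sum.inr v))
    (h𝓖'Q : ∀ v ∈ Q, 𝓖' (Sum.inr v) = W.kummerSelmerStructure n (Sum.inr v) ⊓
      unramifiedSubgroup (GaloisRep.toLocal v (W.torsionGaloisModule n)) 1)
    (h𝓖'nQ : ∀ v ∉ Q, 𝓖' (Sum.inr v) = W.kummerSelmerStructure n (Sum.inr v))
    (h𝓖'inl : ∀ w : InfinitePlace K, 𝓖' (Sum.inl w) ≤ 𝓖 (Sum.inl w)) :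
    𝓖'.selmerGroup ≤ 𝓖.selmerGroup ∧
      𝓖'.selmerGroup.relIndex 𝓖.selmerGroup =
        ∏ v ∈ Q, (W.kummerSelmerStructure n (Sum.inr v)).relIndex
          (W.kummerSelmerStructure n (Sum.inr v) ⊔ unramifiedSubgroup (GaloisRep.toLocal v (W.torsionGaloisModule n)) 1) := by
  have hcount := natCard_selmerGroup_kummerSupUnramified_mul W n e hμ hadd₁ hadd₂ hgal halt hnondeg hn hodd inv hperf
    hsum hcompl Q T hQT hQn hTn hT h𝓚T 𝓖 𝓖' h𝓖Q h𝓖nQ h𝓖'Q h𝓖'nQ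
  -- `𝓖' ≤ 𝓖`
  have hle : 𝓖' ≤ 𝓖 := by
    intro v
    rcases v with w | v
    · exact h𝓖'inl w
    · by_cases hv : v ∈ Q
      · rw [h𝓖'Q v hv, h𝓖Q v hv]; exact inf_le_left.trans le_sup_left
      · rw [h𝓖'nQ v hv, h𝓖nQ v hv]
  have hsel : 𝓖'.selmerGroup ≤ 𝓖.selmerGroup := fun x hx => by
    rw [SelmerStructure.mem_selmerGroup_iff] at hx ⊢
    exact fun v => hle v (hx v)
  refine ⟨hsel, ?_⟩
  -- finiteness
  have hnotT : ∀ v : HeightOneSpectrum (𝓞 K), (Sum.inr v : Place K) ∉ finSupport T → v ∉ T :=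
    fun v hv h => hv ((inr_mem_finSupport_iff T v).2 h)
  have hnotQ : ∀ v : HeightOneSpectrum (𝓞 K), v ∉ T → v ∉ Q := fun v hv h => hv (hQT h)
  have h𝓖'T : 𝓖'.IsUnramifiedOutside (finSupport T) :=
    ⟨fun w => inl_mem_finSupport T w, fun v hv =>
      (h𝓖'nQ v (hnotQ v (hnotT v hv))).trans (h𝓚T v (hnotT v hv))⟩
  haveI : Finite 𝓖'.selmerGroup :=
    SelmerFinite.finite_selmerGroup_of_isUnramifiedOutside (W.torsionGaloisModule n) (fun v hv => hT v (hnotT v hv)) h𝓖'T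
  -- `#H¹_𝓖 = [H¹_𝓖 : H¹_{𝓖'}] · #H¹_{𝓖'}` and `#(𝓚_v ⊔ H¹_ur) = [𝓚_v ⊔ H¹_ur : 𝓚_v] · #𝓚_v`
  have hG : Nat.card 𝓖.selmerGroup = Nat.card 𝓖'.selmerGroup * 𝓖'.selmerGroup.relIndex 𝓖.selmerGroup := by
    rw [← AddSubgroup.relIndex_bot_left 𝓖'.selmerGroup, AddSubgroup.relIndex_mul_relIndex ⊥ _ _ bot_le hsel,
      AddSubgroup.relIndex_bot_left]
  have hloc : ∀ v ∈ Q, Nat.card ↥(W.kummerSelmerStructure n (Sum.inr v) ⊔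
      unramifiedSubgroup (GaloisRep.toLocal v (W.torsionGaloisModule n)) 1) =
      Nat.card (W.kummerSelmerStructure n (Sum.inr v)) * (W.kummerSelmerStructure n (Sum.inr v)).relIndex
        (W.kummerSelmerStructure n (Sum.inr v) ⊔ unramifiedSubgroup (GaloisRep.toLocal v (W.torsionGaloisModule n)) 1) :=
    fun v _ => by
      rw [← AddSubgroup.relIndex_bot_left (W.kummerSelmerStructure n (Sum.inr v)),
        AddSubgroup.relIndex_mul_relIndex ⊥ _ _ bot_le le_sup_left, AddSubgroup.relIndex_bot_left]
  rw [hG, Finset.prod_congr rfl hloc, Finset.prod_mul_distrib] at hcount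
  -- cancel `#H¹_{𝓖'} · ∏_Q #𝓚_v > 0`
  have hpos : 0 < Nat.card 𝓖'.selmerGroup * ∏ v ∈ Q, Nat.card (W.kummerSelmerStructure n (Sum.inr v)) := by
    refine Nat.mul_pos Nat.card_pos (Finset.prod_pos fun v _ => ?_)
    haveI : CharZero (v.adicCompletion K) := charZero_adicCompletion v
    haveI : Finite (galoisCohomology ((W.torsionGaloisModule n).toLocal (Sum.inr v)) 1) :=
      finite_galoisCohomology_one_of_isNonarchimedeanLocalField (GaloisRep.toLocal v (W.torsionGaloisModule n))
    haveI : Finite (W.kummerSelmerStructure n (Sum.inr v)) := inferInstance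
    exact Nat.card_pos
  refine Nat.eq_of_mul_eq_mul_left hpos ?_
  calc Nat.card 𝓖'.selmerGroup * (∏ v ∈ Q, Nat.card (W.kummerSelmerStructure n (Sum.inr v))) *
        𝓖'.selmerGroup.relIndex 𝓖.selmerGroup
      = Nat.card 𝓖'.selmerGroup * 𝓖'.selmerGroup.relIndex 𝓖.selmerGroup *
          ∏ v ∈ Q, Nat.card (W.kummerSelmerStructure n (Sum.inr v)) := by ring
    _ = Nat.card 𝓖'.selmerGroup * ((∏ v ∈ Q, Nat.card (W.kummerSelmerStructure n (Sum.inr v))) *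
          ∏ v ∈ Q, (W.kummerSelmerStructure n (Sum.inr v)).relIndex (W.kummerSelmerStructure n (Sum.inr v) ⊔
            unramifiedSubgroup (GaloisRep.toLocal v (W.torsionGaloisModule n)) 1)) := hcount
    _ = Nat.card 𝓖'.selmerGroup * (∏ v ∈ Q, Nat.card (W.kummerSelmerStructure n (Sum.inr v))) *
          ∏ v ∈ Q, (W.kummerSelmerStructure n (Sum.inr v)).relIndex (W.kummerSelmerStructure n (Sum.inr v) ⊔
            unramifiedSubgroup (GaloisRep.toLocal v (W.torsionGaloisModule n)) 1) := by ring

end WeilData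

end Summit.BirchSwinnertonDyer.Rank1Residual.Additive.KummerUnramified

end
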